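/- Copyright: the b2b-balaban cell (near-miss cell 7), T⁴-continuum fan-out; row NE7b CRUX team (2), seat
t4-ne7b-formalise-leaf-05 (gen 34) — IR-46-2's standing division «… leaf-05 toy-instantiates» applied to leaf-02 g31's
IR-50-2 part 2 «THE KEY-SIDE DECORATION INSTANCE AT THE RECORD» (`HistoryRealiseCellsRunAssemblyWTVSDataLWK`, OWNER g51
W-ne7bp1-g51-1), part 11 of the sanity series (`CLAIMS.log` l.34788).  Released under the licence of the surrounding project. -/
import Summits.QuantumFields.BalabanUV.T4Continuum.Support.HistoryRealiseCellsRunAssemblyWTVSSanityLWK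

/-!
# Sanity for the (α) assembly, part 11: THE KEY-SIDE RECORD `HistReadDataLWK` HAS A KERNEL INHABITANT — ALL 131 FIELDS, NO
DATUM HYPOTHESIS — ON THE CELL's TOY DATUM, AT THE ONE-WORD KEY SIDE (companion of `HistoryRealiseCellsRunAssemblyWTVSDataLWK`;
lineage `t4-ne7b-formalise-leaf-05` gen 34)

Summits-side support leaf of the T⁴-continuum cell (rung (B)+1 on a FINITE torus only; NOT infinite volume, NOT the
mass gap, NOT Clay; NOT a proof of NE7b — NOT PRINTED, NOT PROVED).  [decided toy] over parts 5∕7∕10 and leaf-02 g31's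
IR-50-2 FILE 1, REUSED BY NAME; one toy decoration map (`udec`) and the named toy record; nothing printed asserted, no
`def … : Prop` fact, no cite-tagged hypothesis, zero `sorry`.

§13 the toy key side at letters `β := Unit`: ONE choice word per event (`{()}` — nonempty, a singleton at mergers:
R-OWNER-50-1 ∕ leaf-01 g36 INFO-1 honoured), count letters `1`, the singleton-word decoration **`udec`** of a genealogy
(**`udec_mem_decG`**: a member of `decG (fun _ => {()}) G` for EVERY shape `G` — the (ρ1) display `kdMem`'s target
inhabited even where the display is vacuous; **`card_decG_unit`** ∕ `decG_unit_eq`: it is the ONLY one, so the count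
display `kdCN` at `kdN := 1` is tight), slice envelope `1 ≤ W = 2`; **`one_le_exp_sharpT_zero`**: the share check at zero
shares and count one holds WITH EQUALITY.
§14 **`histReadDataLWK_toyData`** ∕ **`nonempty_histReadDataLWK_toyData`**: `HistReadDataLWK (toyData F G) C₃ O₁ θᵥ 1 1 n hn
(gW F.L S) [] cΛ Lr Φ β₀ 4 2 1 1 1 3 Unit Isk Isk …` — ALL 131 FIELDS, NO DATUM HYPOTHESIS: part 7's `histReadDataLW_toyData`
through part 10's `toLWK`; `kdDied` BY CONSTRUCTION (`died_run_eq_empty₄`), the five key-quantified displays VACUOUS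
(`not_mem_badGMems₄`), `kdV0` at `1`, `kdShare` by `one_le_exp_sharpT_zero` (the elaborator unfolds the toy record's
`φB φR` to `0` — no cast); `kdN_toyData_eq_one`, `kdDec_toyData_mem`.  Part 12 (`…SanityLWKEnd`) runs FILE 2's
`HistReadDataLWK.toLWD` ∕ §2 on it.

HONEST.  «inhabitable» = «no field unsatisfiable as typed, jointly» at toy letters (c2) with `liveCV = ∅`; nothing about
Bałaban's index reading (ρ1), envelopes (ρ2) or the share check (ρ3) on a member of a real reading; (B) FAILS on `toyData`
(FILE 2 §3 has no instance there); BY-NAME EFFECT ON THE WALL: NONE; NE7b NOT proved; spine 0∕9.  HONEST DEPENDENCY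
(cell): continuum YM on T⁴ ⇐ BetaPertH ∧ nine spine estimates (0/9 proved); BetaPertH ⇐ (D1) ∧ (D4) ∧ CAP+tail; G-an2-4
gates asym, D1 and NE2/3/4.  Unchanged here.
-/

open Finset MeasureTheory
open Literature.MathematicalPhysics.QuantumFieldTheory.Balaban1983to89
open T4PersistenceDictionary T4PersistentHistoryCount T4BankedInduction T4PrintedShapeBanking
open T4WeightBudget T4GlobalDenominator T4LiveClassFibration T4LiveStructureGas T4LiveGasToTerms T4RecordPriceSeam
open T4PartnerMultiplicity T4IndicatorShell T4MatchingAssembly T4MatchingClosure T4MatchingClosureSocket T4Continuum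
open T4StabilitySocket T4BranchingRecordsGas T4TaggedShapeBanking T4CanonicalMenus T4RenewalChains
open Literature.MathematicalPhysics.QuantumFieldTheory.Balaban1983to89.B13ScaleTransfer (Pt)
open Summit.QuantumFields.BalabanUV.T4Continuum.HistoryFlow Summit.QuantumFields.BalabanUV.T4Continuum.HistoryGen
open Summit.QuantumFields.BalabanUV.T4Continuum.HistoryGenealogyRealise
open Summit.QuantumFields.BalabanUV.T4Continuum.HistoryGenealogyInstantiate
open Summit.QuantumFields.BalabanUV.T4Continuum.HistoryAssemblyTerms
open Summit.QuantumFields.BalabanUV.T4Continuum.HistoryAssemblyMult Summit.QuantumFields.BalabanUV.T4Continuum.HistoryAssemblyMultKey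
open Summit.QuantumFields.BalabanUV.T4Continuum.HistorySocketTH
open Summit.QuantumFields.BalabanUV.T4Continuum.HistoryRealiseCellsRunApexT3bWTVS
open Summit.QuantumFields.BalabanUV.T4Continuum.HistoryRealiseCellsRunApexT3bWTVSL
open Summit.QuantumFields.BalabanUV.T4Continuum.B16HistoryIndexedRepr
open Summit.QuantumFields.BalabanUV.T4Continuum.B16HistoryIndexedTrunc
open Summit.QuantumFields.BalabanUV.T4Continuum.HistoryConstants Summit.QuantumFields.BalabanUV.T4Continuum.HistoryBankingDiscountCharge
open Summit.QuantumFields.BalabanUV.T4Continuum.HistoryBankingCreditRead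
open Summit.QuantumFields.BalabanUV.T4Continuum.HistoryBankingFibreRoom
open Summit.QuantumFields.BalabanUV.T4Continuum.HistoryBankingFibreResum (ncount ncount_born ncount_renew ncount_merge)
open Summit.QuantumFields.BalabanUV.T4Continuum.HistoryPriceNodeSum Summit.QuantumFields.BalabanUV.T4Continuum.HistoryPriceKeys
open Summit.QuantumFields.BalabanUV.T4Continuum.HistoryRealiseCellsRunSupplyWTVS
open Summit.QuantumFields.BalabanUV.T4Continuum.HistoryRealiseCellsRunSupplyKeysWTVS
open Summit.QuantumFields.BalabanUV.T4Continuum.HistoryRealiseCellsRunSupplyWTVSSanity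
open Summit.QuantumFields.BalabanUV.T4Continuum.HistoryRealiseCellsRunAssemblyWTVSData
open Summit.QuantumFields.BalabanUV.T4Continuum.HistoryRealiseCellsRunAssemblyWTVSDataL
open Summit.QuantumFields.BalabanUV.T4Continuum.HistoryRealiseCellsRunAssemblyWTVSDataLW
open Summit.QuantumFields.BalabanUV.T4Continuum.HistoryRealiseCellsRunAssemblyWTVSDataLWD
open Summit.QuantumFields.BalabanUV.T4Continuum.HistoryRealiseCellsRunAssemblyWTVSDataLWK
open Summit.QuantumFields.BalabanUV.T4Continuum.HistoryRealiseCellsRunAssemblyWTVSLW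
open Summit.QuantumFields.BalabanUV.T4Continuum.HistoryRealiseCellsRunAssemblyWTVSLWD
open Summit.QuantumFields.BalabanUV.T4Continuum.HistoryRealiseCellsRunSupplyFibreWTVS
open Summit.QuantumFields.BalabanUV.T4Continuum.HistoryRealiseCellsRunSupplyFibreKeysWTVS
open Summit.QuantumFields.BalabanUV.T4Continuum.HistoryBankingFibreDecorKeys Summit.QuantumFields.BalabanUV.T4Continuum.HistoryBankingFibreDecorSlice
open Summit.QuantumFields.BalabanUV.T4Continuum.HistoryRealiseCellsRunApexWitness
open Summit.QuantumFields.BalabanUV.T4Continuum.HistoryBankingSharpShares (ell sBsharp)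
open Summit.QuantumFields.BalabanUV.T4Continuum.HistoryBankingRoundingUnrounded (sRunr ApFlat)
open Summit.QuantumFields.BalabanUV.T4Continuum.HistoryBankingRoundingSupply (ellStar)
open Summit.QuantumFields.BalabanUV.T4Continuum.HistoryBankingVolumeWindow (uvol lamVol jvol)
open Summit.QuantumFields.BalabanUV.T4Continuum.HistoryBankingVolumeSupply (ellVol)
open Missing AveragingRT

namespace Summit.QuantumFields.BalabanUV.T4Continuum.HistoryRealiseCellsRunAssemblyWTVSSanity

noncomputable section

open B16HistoryIndexedRepr.Sanity B16HistoryIndexedRepr.SanityInput HistoryConstants.Sanity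

set_option synthInstance.maxSize 1024

/-! ## §13 The toy key side at letters `Unit`: one word per event, the singleton-word decoration -/

section UnitDecor

variable {ε : Type*}

/-- **THE SINGLETON-WORD DECORATION** of a genealogy: every node carries, next to its event, the one letter `()`.
[decided toy] -/
def udec : Gen ε → Gen (ε × Unit)
  | Gen.born b j => Gen.born (b, ()) j
  | Gen.renew G e h => Gen.renew (udec G) (e, ()) h
  | Gen.merge X Y e => Gen.merge (udec X) (udec Y) (e, ())

/-- the node count at the constant letter `1` is `1` [decided toy] -/
theorem ncount_one : ∀ G : Gen ε, ncount (fun _ => 1) G = 1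
  | Gen.born b j => ncount_born _ _ _
  | Gen.renew G e h => by rw [ncount_renew, ncount_one G]
  | Gen.merge X Y e => by rw [ncount_merge, ncount_one X, ncount_one Y]

variable [DecidableEq ε]

/-- **the singleton-word decoration IS a decoration by the one-word choice sets** — for EVERY shape (so the (ρ1) display
`kdMem`'s target `decG (kdC K w) w.2.1` is inhabited at the toy's letters even on members the toy reading never meets).
[decided toy] -/
theorem udec_mem_decG : ∀ G : Gen ε, udec G ∈ decG (fun _ => ({()} : Finset Unit)) G
  | Gen.born b j => by
    rw [decG_born]
    exact Finset.mem_image.2 ⟨(), Finset.mem_singleton_self _, rfl⟩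
  | Gen.renew G e h => by
    rw [decG_renew]
    exact Finset.mem_image.2 ⟨(udec G, ()), Finset.mem_product.2 ⟨udec_mem_decG G, Finset.mem_singleton_self _⟩, rfl⟩
  | Gen.merge X Y e => by
    rw [decG_merge]
    exact Finset.mem_image.2 ⟨((udec X, udec Y), ()),
      Finset.mem_product.2 ⟨Finset.mem_product.2 ⟨udec_mem_decG X, udec_mem_decG Y⟩, Finset.mem_singleton_self _⟩, rfl⟩

/-- **… and it is the ONLY one**: one word per event gives exactly one decoration per member (`card_decG_eq_ncount` at the
constant count `1`) — the count display `kdCN` at `kdN := 1` is TIGHT. [decided toy] -/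
theorem card_decG_unit (G : Gen ε) : (decG (fun _ => ({()} : Finset Unit)) G).card = 1 := by
  rw [card_decG_eq_ncount]
  exact (congrArg (fun N => ncount N G) (funext fun _ => Finset.card_singleton _)).trans (ncount_one G)

/-- `decG` by the one-word choice sets is the singleton of the singleton-word decoration [decided toy] -/
theorem decG_unit_eq (G : Gen ε) : decG (fun _ => ({()} : Finset Unit)) G = {udec G} :=
  (Finset.eq_singleton_iff_unique_mem.2 ⟨udec_mem_decG G, fun _ hx =>
    Finset.card_le_one.1 (card_decG_unit G).le _ hx _ (udec_mem_decG G)⟩)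

end UnitDecor

/-- **THE SHARE CHECK AT ZERO SHARES AND COUNT ONE HOLDS WITH EQUALITY**: `1 ≤ exp (sharpT 0 0 e)` (`= exp 0`). [decided toy] -/
theorem one_le_exp_sharpT_zero (e : PEv) :
    ((1 : ℕ) : ℝ) ≤ Real.exp (sharpT (fun _ _ => (0 : ℝ)) (fun _ => (0 : ℝ)) e) := by
  have h : sharpT (fun _ _ => (0 : ℝ)) (fun _ => (0 : ℝ)) e = 0 := by
    unfold sharpT
    split_ifs <;> rfl
  rw [h, Real.exp_zero, Nat.cast_one]

/-! ## §14 The key-side record on the toy datum — no datum hypothesis -/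

section ToyData

variable (F : T4Family) (G : Type) [GaugeGroup G] [MeasurableSpace G] [HaarData G] [RegularGaugeGroup G]

/-- **THE NAMED INHABITANT OF THE KEY-SIDE RECORD**: part 7's `histReadDataLW_toyData` through `toLWK` at letters `β := Unit`
— one choice word per event, count letters `1`, the singleton-word decoration, slice envelope `1` (`≤ W = 2`); `kdDied` by
`died_run_eq_empty₄`, the five key-quantified displays VACUOUS (`not_mem_badGMems₄`), `kdV0` at `1`, `kdShare` WITH
EQUALITY at the toy's zero shares.  Every `1 ≤ S`, `0 < θᵥ`, `0 ≤ cΛ Lr Φ β₀`. [decided toy] -/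
def histReadDataLWK_toyData {S : ℕ} (hS : 1 ≤ S) {θv : ℝ} (hθv : 0 < θv) {cΛ Lr Φ : ℝ} (hcΛ : 0 ≤ cΛ) (hLr : 0 ≤ Lr)
    (hΦ : 0 ≤ Φ) {β₀ : ℝ} (hβ₀ : 0 ≤ β₀) (n : ℕ) (hn : 0 < n) :
    HistReadDataLWK (toyData F G) C₃ O₁ θv 1 1 n hn (gW F.L S) ([] : List (ULoop F)) cΛ Lr Φ β₀ 4 2 1 1 1 3 Unit
      Isk Isk (fun _ => Unit) μ₀ (fun _ => GoodClass.top Unit) (fun _ => Unit) μ₀ (fun _ => GoodClass.top Unit) :=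
  (histReadDataLW_toyData F G hS hθv hcΛ hLr hΦ hβ₀ n hn).toLWK (fun _ _ _ => ({()} : Finset Unit)) (fun _ _ => 1)
    (fun _ _ w => udec w.2.1) (fun _ _ _ _ => 1)
    (fun K _ τ _ j _ => died_run_eq_empty₄ F.L (F.L ^ S) K τ j)
    (fun K _ k hk => absurd hk (not_mem_badGMems₄ F.L (F.L ^ S) _ _ jhalf K k))
    (fun K _ k hk => absurd hk (not_mem_badGMems₄ F.L (F.L ^ S) _ _ jhalf K k))
    (fun _ _ _ _ _ => zero_le_one)
    (fun K _ _ _ k hk => absurd hk (not_mem_badGMems₄ F.L (F.L ^ S) _ _ jhalf K k))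
    (fun K _ _ _ k hk => absurd hk (not_mem_badGMems₄ F.L (F.L ^ S) _ _ jhalf K k))
    (fun K _ k hk => absurd hk (not_mem_badGMems₄ F.L (F.L ^ S) _ _ jhalf K k))
    (fun _ e => one_le_exp_sharpT_zero e)

/-- **`HistReadDataLWK` IS INHABITED — ALL 131 FIELDS, NO DATUM HYPOTHESIS** — on the toy datum. [decided toy] -/
theorem nonempty_histReadDataLWK_toyData {S : ℕ} (hS : 1 ≤ S) {θv : ℝ} (hθv : 0 < θv) {cΛ Lr Φ : ℝ} (hcΛ : 0 ≤ cΛ)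
    (hLr : 0 ≤ Lr) (hΦ : 0 ≤ Φ) {β₀ : ℝ} (hβ₀ : 0 ≤ β₀) (n : ℕ) (hn : 0 < n) :
    Nonempty (HistReadDataLWK (toyData F G) C₃ O₁ θv 1 1 n hn (gW F.L S) ([] : List (ULoop F)) cΛ Lr Φ β₀ 4 2 1 1 1 3
      Unit Isk Isk (fun _ => Unit) μ₀ (fun _ => GoodClass.top Unit) (fun _ => Unit) μ₀ (fun _ => GoodClass.top Unit)) :=
  ⟨histReadDataLWK_toyData F G hS hθv hcΛ hLr hΦ hβ₀ n hn⟩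

/-- the toy's merger events count EXACTLY one (`kdN := 1`): «mergers count at most one» is attained [decided toy] -/
theorem kdN_toyData_eq_one {S : ℕ} (hS : 1 ≤ S) {θv : ℝ} (hθv : 0 < θv) {cΛ Lr Φ : ℝ} (hcΛ : 0 ≤ cΛ) (hLr : 0 ≤ Lr)
    (hΦ : 0 ≤ Φ) {β₀ : ℝ} (hβ₀ : 0 ≤ β₀) (n : ℕ) (hn : 0 < n) (K : ℕ) (e : PEv) :
    (histReadDataLWK_toyData F G hS hθv hcΛ hLr hΦ hβ₀ n hn).kdN K e = 1 := rfl

/-- the toy's decoration of a member lies in the member's decoration set (the (ρ1) display `kdMem`'s content, pointwise —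
the display itself is vacuous on the toy reading) [decided toy] -/
theorem kdDec_toyData_mem {S : ℕ} (hS : 1 ≤ S) {θv : ℝ} (hθv : 0 < θv) {cΛ Lr Φ : ℝ} (hcΛ : 0 ≤ cΛ) (hLr : 0 ≤ Lr)
    (hΦ : 0 ≤ Φ) {β₀ : ℝ} (hβ₀ : 0 ≤ β₀) (n : ℕ) (hn : 0 < n) (K : ℕ) (τ : HIndex.Idx Isk)
    (w : (Fin 1 → ℕ) × Gen PEv × Multiset (PEv × ((Fin 1 → ℕ) × Finset (Pt 1)))) :
    (histReadDataLWK_toyData F G hS hθv hcΛ hLr hΦ hβ₀ n hn).kdDec K τ w ∈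
      decG ((histReadDataLWK_toyData F G hS hθv hcΛ hLr hΦ hβ₀ n hn).kdC K w) w.2.1 :=
  udec_mem_decG w.2.1

end ToyData

end

end Summit.QuantumFields.BalabanUV.T4Continuum.HistoryRealiseCellsRunAssemblyWTVSSanity
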